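import Summits.AtomisticToContinuum.Crystallization.Theorems.FrustratedLawDichotomyCellF1Labels

/-!
# FrustratedLawDichotomy · crux `AperiodicFrustratedLawGap` (stmt-AtomisticToContinuum-27623) — class-A K-file skeleton, layer 2b:
orbit representatives of the F1 cell (decomp-a2c hand-2 g47, structural share; KFILE-FORMAT ed2+A §3′/§5′ «readings on ORBIT
REPRESENTATIVES only», (272) `nn_of_reps` / `hf_of_reps` / `fc_of_reps`)

With `Stab16` §5 (`exists_act_rep16`, `symOf16_spec`) the representative bookkeeping of a uniaxial cell is STRUCTURAL.  This file specialises it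
to F1: the class key, label admissibility and interior admissibility are constant on orbits (`qk_rep16`, `admL_rep16`, `admI_rep16`), so
representatives of labels are labels (`rep16_mem_M`, `rep16_mem_MI`); and ★ `hcov_list` — for ANY label list `L` (the near list `MN`, the
interior list …) with `Reps := (L.map rep16).toFinset`, the `hcov` hypothesis of (272) `nn_of_reps` holds with NO decision at all:
`∀ m ∈ L.toFinset, rep16 m ∈ Reps ∧ actZ (RZ (symOf16 m)) (rep16 m) = m`.  What remains per cell is only the per-REPRESENTATIVE reading table
(census data, hand-1 readings) over the explicit list `(L.map rep16).dedup`.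
-/

namespace Summit.AtomisticToContinuum.Crystallization.Theorems.FrustratedLawDichotomyCellF1Reps

open Summit.AtomisticToContinuum.Crystallization.Theorems.FrustratedLawDichotomyCellSymmZ3 (actZ)
open Summit.AtomisticToContinuum.Crystallization.Theorems.FrustratedLawDichotomyCellStab16
  (RZ rep16 symOf16 exists_act_rep16 symOf16_spec rep16_act)
open Summit.AtomisticToContinuum.Crystallization.Theorems.FrustratedLawDichotomyCellF1Frame (qk admL admI qk_act admL_act admI_act)
open Summit.AtomisticToContinuum.Crystallization.Theorems.FrustratedLawDichotomyCellF1Labels (MF1 MIF1 mem_M mem_MI labF1 intF1)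

/-- the class key is constant on orbits: `qk (rep16 m) = qk m`. -/
theorem qk_rep16 (m : ℤ × ℤ × ℤ) : qk (rep16 m) = qk m := by
  obtain ⟨k, hk⟩ := exists_act_rep16 m
  conv_rhs => rw [← hk]
  rw [qk_act]

/-- label admissibility is constant on orbits. -/
theorem admL_rep16 (m : ℤ × ℤ × ℤ) : admL (rep16 m) = admL m := by
  obtain ⟨k, hk⟩ := exists_act_rep16 m
  conv_rhs => rw [← hk]
  rw [admL_act]

/-- interior admissibility is constant on orbits. -/
theorem admI_rep16 (m : ℤ × ℤ × ℤ) : admI (rep16 m) = admI m := by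
  obtain ⟨k, hk⟩ := exists_act_rep16 m
  conv_rhs => rw [← hk]
  rw [admI_act]

/-- the representative of a label is a label. -/
theorem rep16_mem_M {m : ℤ × ℤ × ℤ} (hm : m ∈ MF1) : rep16 m ∈ MF1 := mem_M.mpr (by rw [admL_rep16]; exact mem_M.mp hm)

/-- the representative of an interior label is an interior label. -/
theorem rep16_mem_MI {m : ℤ × ℤ × ℤ} (hm : m ∈ MIF1) : rep16 m ∈ MIF1 := mem_MI.mpr (by rw [admI_rep16]; exact mem_MI.mp hm)

/-- ★ the `hcov` hypothesis of (272) `nn_of_reps` for ANY label list, with the representatives COLLECTED from the list — structural, no decision. -/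
theorem hcov_list (L : List (ℤ × ℤ × ℤ)) :
    ∀ m ∈ L.toFinset, rep16 m ∈ (L.map rep16).toFinset ∧ actZ (RZ (symOf16 m)) (rep16 m) = m :=
  fun m hm => ⟨List.mem_toFinset.mpr (List.mem_map.mpr ⟨m, List.mem_toFinset.mp hm, rfl⟩), symOf16_spec m⟩

/-- the same for a `Finset` of labels given with any representative set containing the images. -/
theorem hcov_of_subset {S Reps : Finset (ℤ × ℤ × ℤ)} (hR : ∀ m ∈ S, rep16 m ∈ Reps) :
    ∀ m ∈ S, rep16 m ∈ Reps ∧ actZ (RZ (symOf16 m)) (rep16 m) = m :=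
  fun m hm => ⟨hR m hm, symOf16_spec m⟩

/-- representatives of a `Stab16`-image coincide (so per-representative tables are read consistently along orbits). -/
theorem rep16_of_act (k : Fin 16) (m : ℤ × ℤ × ℤ) : rep16 (actZ (RZ k) m) = rep16 m := rep16_act k m

/-- the interior representatives, as an explicit list (43 of them, census N9′-F1-54 `Reps(MI)`). -/
def repsI : List (ℤ × ℤ × ℤ) := (intF1.map rep16).dedup

/-- every interior label's representative is listed. -/
theorem rep16_mem_repsI {m : ℤ × ℤ × ℤ} (hm : m ∈ MIF1) : rep16 m ∈ repsI := by
  rw [repsI, List.mem_dedup, List.mem_map]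
  exact ⟨m, by rwa [MIF1, List.mem_toFinset] at hm, rfl⟩

/-- ★ the F1 interior has exactly `43` orbit representatives (census ✓; decided on the 403-element list). -/
theorem repsI_length : repsI.length = 43 := by decide +kernel

end Summit.AtomisticToContinuum.Crystallization.Theorems.FrustratedLawDichotomyCellF1Reps
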